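import Summits.HodgeConjecture.HodgeConjecture.Theorems.K2E1ChiLocalWeightNonsplitU2       -- ★ p862220 (this seat) FILE 1: `chiLocalMean_eq_chiLocalScalar_of_shells` ((T) for a shell-geometric weight); brings the `P_v` token files
import Summits.HodgeConjecture.HodgeConjecture.Theorems.K2LiuGKRankOneValue                -- ★ `chi_eq_of_valued_eq_one`, `valued_eq_exp_of_mem_shell` (shell ⇒ `v(t) = exp(m+1)`)
import Summits.HodgeConjecture.HodgeConjecture.Theorems.K2LiuRankOneLevelHolomorphy         -- ★ `normAbs_eq_one_iff_valued_eq_one` (`‖δ‖_w = 1 ↔ v_w(δ) = 1`)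
import HarnessLib

/-!
# K2·E1 ∕ R90·S8 — `K2E1ChiLocalWeightShellU2` (J2′-2-NONSPLIT, FILE 2): the Iwasawa weight `t ↦ ∏_{w∣v} χ_w(−(ι_w t·δ_w)⁻¹)` of an UNRAMIFIED `χ` is
# SHELL-GEOMETRIC with parameter `e = ∏_{w∣v} χ_w(ι_w ϖ_v)`, hence its `χ`-weighted local mean is E1's local `χ`-scalar (letter (T) of J2′-1, discharged)

Cell `pub/hodgecm-mathlib`, crux h413 = `stmt-HodgeConjecture-24833`, route of record `HCCMUnconditional`; R90-TF section S8 «ContSpec-n½», deal S8-R19 ∕ S8-R22 (R90-CS-plan (g2))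
«J2′-2-NONSPLIT» to R90-C10-p07 (g0), FILE 2 (FILE 1 = ★ p862220 `K2E1ChiLocalWeightNonsplitU2`).  THEOREMS ONLY (no `def`, no `instance`, no notation, no named-fact
hypothesis, no `sorry`; default heartbeats); lane `--supports stmt-HodgeConjecture-24833 --as helper` (count-neutral; closes no socket).

THE MATHEMATICS ([Casselman1980, §3]; [Tate1950, §2.2]; [MoeglinWaldspurger1995, II.1.6]).  By FILE 1 §1 the Iwasawa torus entry of `w₀·n(x)`, `x = ι_w t · δ_w` with `|x|_w ≥ 1`, is
`−x⁻¹`; so the local weight of a `χ`-spherical section along the big-cell line is `ω_v(t) = ∏_{w∣v} χ_w(−(ι_w t·δ_w)⁻¹)` off `𝒪_v` (and `1` on `𝒪_v`).  For `χ_w` UNRAMIFIED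
(`χ_w(u) = 1` when `v_w(u) = 1`) the value `χ_w(a)` depends only on `v_w(a)` (★ `K2LiuGKRankOneValue.chi_eq_of_valued_eq_one`); on the shell `|t|_v = q_v^{m+1}` one has
`v_w(−(ι_w t·δ_w)⁻¹) = v_w(ι_w t)⁻¹ = v_v(t)^{−e(w|v)} = v_w(ι_w ϖ_v)^{m+1}` (★ `Extension.valued_adicCompletionSemialgHom`: `v_w(ι_w y) = v_v(y)^{e(w|v)}`; `v_w(δ_w) = 1`), whence
`χ_w(−(ι_w t·δ_w)⁻¹) = χ_w(ι_w ϖ_v)^{m+1}` for EVERY `w ∣ v` — inert, ramified or split alike — and `ω_v(t) = e^{m+1}`, `e := ∏_{w∣v} χ_w(ι_w ϖ_v)` (= `ε.valueAtUniformizer v` for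
`ε = χ|_{𝕀_{L⁺}}` by ★ J1a-dict `K2E1ChiIntertwiningLocalScalarFromK2LiuU2.unramValue_chiF_localComponent_eq_valueAtUniformizer`, stated there with K2Liu's `toPlace`; the identification
`toPlace = Extension.adicCompletionSemialgHom` of the two canonical maps `L⁺_v → L_w` is NOT asserted here — `e` is kept as the explicit product).  FILE 1 §3 then gives (T).
* §1 `chi_eq_pow_of_valued_eq` — unramified `χ_w`: `v_w(a) = v_w(π)^n ⇒ χ_w(a) = χ_w(π)^n` (generic on `L_w`).
* §2 **`chi_neg_inv_line_eq_pow`** — the per-`w` shell value `χ_w(−(ι_w t·δ_w)⁻¹) = χ_w(ι_w ϖ_v)^{m+1}` on shell `m` (hypothesis-first in the unit representatives `a`, `π`).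
* §3 **`weight_eq_pow_of_mem_shell`** — the product weight is shell-geometric: `ω_v(t) = (∏_{w∣v} χ_w(π_w))^{m+1}` on shell `m`; `norm_prod_chi_le_one` — `‖e‖ ≤ 1` for `‖χ_w‖ ≤ 1`.
* §4 **`chiLocalMean_weight_eq_chiLocalScalar`** — (T) DISCHARGED for this weight: `ν_v(𝒪_v)⁻¹ ∫ ω_v·P_v^{−z} = (1 − e q_v^{−2z})(1 − e q_v^{−(2z−1)})⁻¹`, `½ < Re z`, in the bytes of
  ★ `differentiableOn_chiLocalMean` ∕ ★ `hasProd_chiLocalScalar` (★ FILE 1 `chiLocalMean_eq_chiLocalScalar_of_shells`).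
HONEST LABEL: HC_CM is proved only modulo the 7 printed citations (2 remaining named inputs: hLiu418 = `stmt-HodgeConjecture-24832`, h413 = `stmt-HodgeConjecture-24833`) until rung 0
closes; REL ≠ ★ ≠ BUILT; this file asserts no named fact and closes no socket; count-neutral.

## References
* [Casselman1980] W. Casselman, *The unramified principal series of p-adic groups I*, Compositio Math. 40 (1980), §3 Thm. 3.1.
* [Tate1950] J. Tate, *Fourier analysis in number fields and Hecke's zeta-functions* (1950), §2.2 (shells of a local field).
* [MoeglinWaldspurger1995] C. Mœglin, J.-L. Waldspurger, *Spectral Decomposition and Eisenstein Series* (1995), II.1.6.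
* [NeukirchANT1999] J. Neukirch, *Algebraic Number Theory* (1999), Ch. II Thm. (4.8) (`v_w ∘ ι_w = v_v^{e}`).
-/

set_option autoImplicit false
set_option linter.dupNamespace false

noncomputable section

open MeasureTheory Measure NumberField IsDedekindDomain IsDedekindDomain.HeightOneSpectrum Set
open scoped NNReal ENNReal
open Literature.NumberTheory.GaloisRepresentations.IsNonarchimedeanLocalField Literature.NumberTheory.Automorphic Literature.NumberTheory.Automorphic.LocalFieldHaar
open Summit.HodgeConjecture.HodgeConjecture.Cruxes.HLiu418.K2LiuGKRankOneValue (chi_eq_of_valued_eq_one valued_eq_exp_of_mem_shell)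
open Summit.HodgeConjecture.HodgeConjecture.Cruxes.HLiu418.K2LiuGKRankOneIntegral (not_mem_primePowBall_zero_of_mem_outerShell)
open Summit.HodgeConjecture.HodgeConjecture.Cruxes.HLiu418.K2LiuRankOneLevelHolomorphy (normAbs_eq_one_iff_valued_eq_one)

namespace Summit.HodgeConjecture.HodgeConjecture.Cruxes.H413.K2E1ChiLocalWeightShellU2

variable (L : Type) [Field L] [NumberField L] [IsCMField L]

/-! ## §1 Unramified characters see valuations only -/

omit [IsCMField L] in
/-- **Unramified `χ_w`: `v_w(a) = v_w(π)^n ⇒ χ_w(a) = χ_w(π)^n`** (★ `chi_eq_of_valued_eq_one` at `u₁ = a`, `u₂ = π^n`). [cite: Casselman1980, §3] -/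
theorem chi_eq_pow_of_valued_eq {w : HeightOneSpectrum (𝓞 L)} (χw : (w.adicCompletion L)ˣ →* ℂˣ)
    (hχ : ∀ u : (w.adicCompletion L)ˣ, Valued.v (u : w.adicCompletion L) = 1 → χw u = 1)
    (a π : (w.adicCompletion L)ˣ) (n : ℕ) (h : Valued.v (a : w.adicCompletion L) = Valued.v (π : w.adicCompletion L) ^ n) :
    χw a = χw π ^ n := by
  rw [← map_pow]
  refine chi_eq_of_valued_eq_one L χw hχ a (π ^ n) ?_
  have hπ0 : Valued.v (π : w.adicCompletion L) ≠ 0 := (Valuation.ne_zero_iff _).2 π.ne_zero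
  rw [Units.val_mul, Units.val_inv_eq_inv_val, Units.val_pow_eq_pow_val, map_mul, map_inv₀, map_pow, h, mul_inv_cancel₀ (pow_ne_zero _ hπ0)]

/-! ## §2 The per-place shell value `χ_w(−(ι_w t·δ_w)⁻¹) = χ_w(ι_w ϖ_v)^{m+1}` -/

variable {δ : L} (v : HeightOneSpectrum (𝓞 ↥(maximalRealSubfield L)))

omit [IsCMField L] in
/-- **THE SHELL VALUE OF THE IWASAWA WEIGHT, per place `w ∣ v`**: for `χ_w` unramified, `v_w(δ_w) = 1`, `ϖ` a uniformizer of `L⁺_v` and `t` on the shell `|t|_v = q_v^{m+1}`: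
`χ_w(a) = χ_w(π)^{m+1}` for units `a`, `π` of `L_w` with `a = −(ι_w t·δ_w)⁻¹`, `π = ι_w ϖ` (`ι_w = Extension.adicCompletionSemialgHom`, `δ_w` the `w`-component of `δ`) — all place types.
[cite: Casselman1980, §3 Thm. 3.1] [cite: NeukirchANT1999, Ch. II Thm. (4.8)] [cite: Tate1950, §2.2] -/
theorem chi_neg_inv_line_eq_pow (w : v.Extension (𝓞 L)) (χw : (w.1.adicCompletion L)ˣ →* ℂˣ)
    (hχ : ∀ u : (w.1.adicCompletion L)ˣ, Valued.v (u : w.1.adicCompletion L) = 1 → χw u = 1)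
    (hδw : Valued.v ((algebraMap L (FiniteAdeleRing (𝓞 L) L) δ) w.1) = 1)
    {ϖ : v.adicCompletion ↥(maximalRealSubfield L)} (hϖ : Valued.v ϖ = WithZero.exp (-1 : ℤ)) (m : ℕ)
    {t : v.adicCompletion ↥(maximalRealSubfield L)}
    (ht : t ∈ primePowBall (v.adicCompletion ↥(maximalRealSubfield L)) (-((m : ℤ) + 1)) \ primePowBall (v.adicCompletion ↥(maximalRealSubfield L)) (-((m : ℤ) + 1) + 1))
    (a π : (w.1.adicCompletion L)ˣ)
    (ha : (a : w.1.adicCompletion L) = -(Extension.adicCompletionSemialgHom ↥(maximalRealSubfield L) L w t * (algebraMap L (FiniteAdeleRing (𝓞 L) L) δ) w.1)⁻¹)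
    (hπ : (π : w.1.adicCompletion L) = Extension.adicCompletionSemialgHom ↥(maximalRealSubfield L) L w ϖ) :
    χw a = χw π ^ (m + 1) := by
  refine chi_eq_pow_of_valued_eq L χw hχ a π (m + 1) ?_
  have htv := valued_eq_exp_of_mem_shell ↥(maximalRealSubfield L) v m ht
  rw [ha, hπ, Valuation.map_neg, map_inv₀, map_mul, hδw, mul_one, Extension.valued_adicCompletionSemialgHom, Extension.valued_adicCompletionSemialgHom,
    htv, hϖ, ← inv_pow, ← WithZero.exp_neg]
  conv_rhs => rw [← pow_mul, mul_comm, pow_mul]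
  congr 1
  rw [← WithZero.exp_nsmul]
  congr 1
  push_cast [nsmul_eq_mul]
  ring

/-! ## §3 The product weight `ω_v(t) = ∏_{w∣v} χ_w(−(ι_w t·δ_w)⁻¹)` (off `𝒪_v`) is shell-geometric with parameter `e = ∏_{w∣v} χ_w(ι_w ϖ_v)` -/

omit [IsCMField L] in
/-- **THE IWASAWA WEIGHT IS SHELL-GEOMETRIC.**  Hypothesis-first in the weight: `ω_v : L⁺_v → ℂ` with `ω_v(t) = ∏_{w∣v} χ_w(a_w(t))` off `𝒪_v`, where the units `a_w(t)` of `L_w`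
represent `−(ι_w t·δ_w)⁻¹` (the first Iwasawa torus entry of `w₀·n(ι_w t·δ_w)`, ★ FILE 1 `exists_borel_mul_lower_eq_weyl_mul_lineUnipotent`) and `π_w` represents `ι_w ϖ_v`; `χ_w` unramified,
`v_w(δ_w) = 1` for all `w ∣ v`.  Then on the shell `|t|_v = q_v^{m+1}`: `ω_v(t) = e^{m+1}`, `e = ∏_{w∣v} χ_w(π_w)`. [cite: Casselman1980, §3 Thm. 3.1] [cite: Tate1950, §2.2] -/
theorem weight_eq_pow_of_mem_shell
    (χ : ∀ w : v.Extension (𝓞 L), (w.1.adicCompletion L)ˣ →* ℂˣ)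
    (hχ : ∀ (w : v.Extension (𝓞 L)) (u : (w.1.adicCompletion L)ˣ), Valued.v (u : w.1.adicCompletion L) = 1 → χ w u = 1)
    (hδw : ∀ w : v.Extension (𝓞 L), Valued.v ((algebraMap L (FiniteAdeleRing (𝓞 L) L) δ) w.1) = 1)
    {ϖ : v.adicCompletion ↥(maximalRealSubfield L)} (hϖ : Valued.v ϖ = WithZero.exp (-1 : ℤ))
    (a : ∀ w : v.Extension (𝓞 L), v.adicCompletion ↥(maximalRealSubfield L) → (w.1.adicCompletion L)ˣ)
    (ha : ∀ (w : v.Extension (𝓞 L)) (t : v.adicCompletion ↥(maximalRealSubfield L)), t ∉ v.adicCompletionIntegers ↥(maximalRealSubfield L) →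
      ((a w t : (w.1.adicCompletion L)ˣ) : w.1.adicCompletion L) =
        -(Extension.adicCompletionSemialgHom ↥(maximalRealSubfield L) L w t * (algebraMap L (FiniteAdeleRing (𝓞 L) L) δ) w.1)⁻¹)
    (π : ∀ w : v.Extension (𝓞 L), (w.1.adicCompletion L)ˣ)
    (hπ : ∀ w : v.Extension (𝓞 L), ((π w : (w.1.adicCompletion L)ˣ) : w.1.adicCompletion L) = Extension.adicCompletionSemialgHom ↥(maximalRealSubfield L) L w ϖ)
    (ω : v.adicCompletion ↥(maximalRealSubfield L) → ℂ)
    (hωout : ∀ t : v.adicCompletion ↥(maximalRealSubfield L), t ∉ v.adicCompletionIntegers ↥(maximalRealSubfield L) →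
      ω t = (letI := Extension.fintype (𝓞 ↥(maximalRealSubfield L)) ↥(maximalRealSubfield L) L (𝓞 L) v; ∏ w : v.Extension (𝓞 L), ((χ w (a w t) : ℂˣ) : ℂ)))
    (m : ℕ) (t : v.adicCompletion ↥(maximalRealSubfield L))
    (ht : t ∈ primePowBall (v.adicCompletion ↥(maximalRealSubfield L)) (-((m : ℤ) + 1)) \ primePowBall (v.adicCompletion ↥(maximalRealSubfield L)) (-((m : ℤ) + 1) + 1)) :
    ω t = (letI := Extension.fintype (𝓞 ↥(maximalRealSubfield L)) ↥(maximalRealSubfield L) L (𝓞 L) v; ∏ w : v.Extension (𝓞 L), ((χ w (π w) : ℂˣ) : ℂ)) ^ (m + 1) := by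
  letI := Extension.fintype (𝓞 ↥(maximalRealSubfield L)) ↥(maximalRealSubfield L) L (𝓞 L) v
  have ht0 : t ∉ v.adicCompletionIntegers ↥(maximalRealSubfield L) := fun h =>
    not_mem_primePowBall_zero_of_mem_outerShell ht ((mem_primePowBall_zero_iff t).2 h)
  rw [hωout t ht0, ← Finset.prod_pow]
  refine Finset.prod_congr rfl fun w _ => ?_
  rw [← Units.val_pow_eq_pow_val, chi_neg_inv_line_eq_pow L v w (χ w) (hχ w) (hδw w) hϖ m ht (a w t) (π w) (ha w t ht0) (hπ w)]

omit [IsCMField L] in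
/-- **`‖e‖ ≤ 1`** for `e = ∏_{w∣v} χ_w(π_w)` when every `χ_w` takes values of modulus `≤ 1` (e.g. unitary). [folklore] -/
theorem norm_prod_chi_le_one
    (χ : ∀ w : v.Extension (𝓞 L), (w.1.adicCompletion L)ˣ →* ℂˣ) (hχb : ∀ (w : v.Extension (𝓞 L)) (u : (w.1.adicCompletion L)ˣ), ‖((χ w u : ℂˣ) : ℂ)‖ ≤ 1)
    (π : ∀ w : v.Extension (𝓞 L), (w.1.adicCompletion L)ˣ) :
    ‖(letI := Extension.fintype (𝓞 ↥(maximalRealSubfield L)) ↥(maximalRealSubfield L) L (𝓞 L) v; ∏ w : v.Extension (𝓞 L), ((χ w (π w) : ℂˣ) : ℂ))‖ ≤ 1 := by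
  letI := Extension.fintype (𝓞 ↥(maximalRealSubfield L)) ↥(maximalRealSubfield L) L (𝓞 L) v
  exact (Finset.norm_prod_le _ _).trans (Finset.prod_le_one (fun w _ => norm_nonneg _) fun w _ => hχb w (π w))

/-! ## §4 (T) DISCHARGED for the Iwasawa weight: `ν_v(𝒪_v)⁻¹ ∫ ω_v·P_v^{−z} = (1 − e q_v^{−2z})(1 − e q_v^{−(2z−1)})⁻¹` -/

/-- **LETTER (T) OF J2′-1 FOR THE IWASAWA WEIGHT OF AN UNRAMIFIED `χ`.**  At a finite place `v` of `L⁺` with `‖δ‖_w = 1` for all `w ∣ v`, for `χ_w` unramified with `‖χ_w‖ ≤ 1`, `ϖ` a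
uniformizer of `L⁺_v`, `½ < Re z`, and a weight `ω_v` that is `1` on `𝒪_v` and `∏_{w∣v} χ_w(a_w(t))` off `𝒪_v` (`a_w(t) = −(ι_w t·δ_w)⁻¹`, `π_w = ι_w ϖ_v` as units):
`t ↦ ω_v(t)·P_v(t)^{−z}` is integrable and `ν_v(𝒪_v)⁻¹ ∫ ω_v·P_v^{−z} dν_v = (1 − e·q_v^{−2z})·(1 − e·q_v^{−(2z−1)})⁻¹`, `e = ∏_{w∣v} χ_w(π_w)` — integrand bytes of ★
`K2E1ChiIntertwiningLocalFactorHolomorphicU2.differentiableOn_chiLocalMean`, token bytes of ★ `K2E1ChiIntertwiningScalarEulerQuotientU2.hasProd_chiLocalScalar` with `ε.valueAtUniformizer v ↦ e`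
(§3 + ★ FILE 1 `chiLocalMean_eq_chiLocalScalar_of_shells`). [cite: Casselman1980, §3 Thm. 3.1] [cite: Langlands1976, Appendix] [cite: Rogawski1990, §13.9 p. 229] -/
theorem chiLocalMean_weight_eq_chiLocalScalar
    [MeasurableSpace (v.adicCompletion ↥(maximalRealSubfield L))] [BorelSpace (v.adicCompletion ↥(maximalRealSubfield L))]
    (μ : Measure (v.adicCompletion ↥(maximalRealSubfield L))) [μ.IsAddHaarMeasure]
    (hv : ∀ w : v.Extension (𝓞 L), normAbs (w.1.adicCompletion L) ((algebraMap L (FiniteAdeleRing (𝓞 L) L) δ) w.1) = 1)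
    (χ : ∀ w : v.Extension (𝓞 L), (w.1.adicCompletion L)ˣ →* ℂˣ)
    (hχ : ∀ (w : v.Extension (𝓞 L)) (u : (w.1.adicCompletion L)ˣ), Valued.v (u : w.1.adicCompletion L) = 1 → χ w u = 1)
    (hχb : ∀ (w : v.Extension (𝓞 L)) (u : (w.1.adicCompletion L)ˣ), ‖((χ w u : ℂˣ) : ℂ)‖ ≤ 1)
    {ϖ : v.adicCompletion ↥(maximalRealSubfield L)} (hϖ : Valued.v ϖ = WithZero.exp (-1 : ℤ))
    (a : ∀ w : v.Extension (𝓞 L), v.adicCompletion ↥(maximalRealSubfield L) → (w.1.adicCompletion L)ˣ)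
    (ha : ∀ (w : v.Extension (𝓞 L)) (t : v.adicCompletion ↥(maximalRealSubfield L)), t ∉ v.adicCompletionIntegers ↥(maximalRealSubfield L) →
      ((a w t : (w.1.adicCompletion L)ˣ) : w.1.adicCompletion L) =
        -(Extension.adicCompletionSemialgHom ↥(maximalRealSubfield L) L w t * (algebraMap L (FiniteAdeleRing (𝓞 L) L) δ) w.1)⁻¹)
    (π : ∀ w : v.Extension (𝓞 L), (w.1.adicCompletion L)ˣ)
    (hπ : ∀ w : v.Extension (𝓞 L), ((π w : (w.1.adicCompletion L)ˣ) : w.1.adicCompletion L) = Extension.adicCompletionSemialgHom ↥(maximalRealSubfield L) L w ϖ)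
    {z : ℂ} (hz : 1 / 2 < z.re)
    (ω : v.adicCompletion ↥(maximalRealSubfield L) → ℂ)
    (hω0 : ∀ t ∈ v.adicCompletionIntegers ↥(maximalRealSubfield L), ω t = 1)
    (hωout : ∀ t : v.adicCompletion ↥(maximalRealSubfield L), t ∉ v.adicCompletionIntegers ↥(maximalRealSubfield L) →
      ω t = (letI := Extension.fintype (𝓞 ↥(maximalRealSubfield L)) ↥(maximalRealSubfield L) L (𝓞 L) v; ∏ w : v.Extension (𝓞 L), ((χ w (a w t) : ℂˣ) : ℂ))) :
    Integrable (fun t : v.adicCompletion ↥(maximalRealSubfield L) => ω t * ((((letI := Extension.fintype (𝓞 ↥(maximalRealSubfield L)) ↥(maximalRealSubfield L) L (𝓞 L) v; ∏ w : v.Extension (𝓞 L), max 1 (normAbs (w.1.adicCompletion L) (Extension.adicCompletionSemialgHom ↥(maximalRealSubfield L) L w t) * normAbs (w.1.adicCompletion L) ((algebraMap L (FiniteAdeleRing (𝓞 L) L) δ) w.1))) : ℝ≥0) : ℝ) : ℂ) ^ (-z)) μ ∧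
    ((((μ (v.adicCompletionIntegers ↥(maximalRealSubfield L))).toReal⁻¹ : ℝ)) : ℂ) *
      ∫ t : v.adicCompletion ↥(maximalRealSubfield L), ω t * ((((letI := Extension.fintype (𝓞 ↥(maximalRealSubfield L)) ↥(maximalRealSubfield L) L (𝓞 L) v; ∏ w : v.Extension (𝓞 L), max 1 (normAbs (w.1.adicCompletion L) (Extension.adicCompletionSemialgHom ↥(maximalRealSubfield L) L w t) * normAbs (w.1.adicCompletion L) ((algebraMap L (FiniteAdeleRing (𝓞 L) L) δ) w.1))) : ℝ≥0) : ℝ) : ℂ) ^ (-z) ∂μ =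
    (1 - (letI := Extension.fintype (𝓞 ↥(maximalRealSubfield L)) ↥(maximalRealSubfield L) L (𝓞 L) v; ∏ w : v.Extension (𝓞 L), ((χ w (π w) : ℂˣ) : ℂ)) * (v.residueCard : ℂ) ^ (-(2 * z))) *
      (1 - (letI := Extension.fintype (𝓞 ↥(maximalRealSubfield L)) ↥(maximalRealSubfield L) L (𝓞 L) v; ∏ w : v.Extension (𝓞 L), ((χ w (π w) : ℂˣ) : ℂ)) * (v.residueCard : ℂ) ^ (-(2 * z - 1)))⁻¹ := by
  have hδw : ∀ w : v.Extension (𝓞 L), Valued.v ((algebraMap L (FiniteAdeleRing (𝓞 L) L) δ) w.1) = 1 :=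
    fun w => (normAbs_eq_one_iff_valued_eq_one _).1 (hv w)
  exact K2E1ChiLocalWeightNonsplitU2.chiLocalMean_eq_chiLocalScalar_of_shells L v μ hv (norm_prod_chi_le_one L v χ hχb π) hz ω hω0
    (fun m t ht => weight_eq_pow_of_mem_shell L v χ hχ hδw hϖ a ha π hπ ω hωout m t ht)

end Summit.HodgeConjecture.HodgeConjecture.Cruxes.H413.K2E1ChiLocalWeightShellU2

end
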